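import Summits.BirchSwinnertonDyer.BirchSwinnertonDyer.Theorems.ClassRecordThreeCornerAtThreeUpperShimuraSavedDefs
import Summits.BirchSwinnertonDyer.BirchSwinnertonDyer.Theorems.ErratumRoadFiveNonSurjCornerTamagawaCarriersAnyPrime
import Summits.BirchSwinnertonDyer.Rank1Residual.X11b.Three.TamagawaAtomShapes
import Literature.NumberTheory.EllipticCurves.PAdicBSDSplitMultiplicativeProofs
import HarnessLib

/-!
# Crux `CornerAtThreeW` (item stmt-BirchSwinnertonDyer-21420; 19111 `CornerAtThree` aside), conjunct (U): THE CARRIER-INERT ADMISSIBILITY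
# (`Three.CornerInertAdmissible` ∕ `…UpToOne`) IS AUTOMATIC OFF (T2γ) WITH AT MOST TWO SPLIT MULTIPLICATIVE PRIMES OTHER THAN 3 —
# the residual binder «multi ∧ ¬Adm ∧ ¬AdmUpToOne» of lane B's `stub_upper3_residualMulti` (r4b) in CLEAN shape:
# (T2γ) [an additive place of type IV ∕ IV* with `c = 3`] OR three split multiplicative primes `≠ 3`
# (cell `bsd-stepL`, seat `bsd-stepL-corner-p1` g13 — the `p = 3` twin of this seat's `…NonSurjCornerHybridThreeSplit`; `--supports 21420 --as helper`)

WHY THIS FILE. Lane B corner3-p2's registered line for 21420 (`Lines/inert.lean` r3 → r4b) books the (T4″)₃ corner's upper half through the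
carrier-inert Shimura road on `Three.CornerInertAdmissible W` (g3 ∕ g4), its SAVED twin on `Three.CornerInertAdmissibleUpToOne W` (g6), and keeps the
IMC-grade `Three.CornerCoStepLAt` only on «multi-carrier ∧ ¬Adm ∧ ¬AdmUpToOne» (census N < 5·10⁵: 0 pairs). THIS FILE proves that, OFF the additive
shape (T2γ) (`¬ Three.ShapeGamma W`), the two admissibility predicates are AUTOMATIC at every multi-carrier corner curve with AT MOST TWO split
multiplicative primes `≠ 3` — no congruence condition, because the Papikian–Rabinoff half `R = {3}` always qualifies (`3 ∤ 3 − 1`): a multi-carrier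
corner curve off (T2γ) has two distinct split places (lane B corner5-p2 g4's `CornerLocal.CornerAtThree.forall_lt_iff_exists_two`; a place with `c_v = 3`
that is not split is of type IV ∕ IV*, i.e. (T2γ)), hence a split multiplicative `q ≠ 3`; if `q` is the only one, `S = {3, q}`, `R = {3}` is admissible
(full SHAPE from `¬ShapeGamma`, `Three.hshape_of_not_shapeGamma`); if there is a second `q'`, exempt it (`S = {3, q}`, `q' ∉ S`, `R = {3}`; a split
offender outside would be a THIRD). Hence the residual binder of `stub_upper3_residualMulti` is implied by the CLEAN shape
  «(T2γ) ∨ three distinct split multiplicative primes `q₁, q₂, q₃ ≠ 3`» —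
* `Three.cornerInertAdmissible_or_upToOne_of_not_shapeGamma_of_atMostTwoSplit` — ¬(T2γ) ∧ multi ∧ «no three split primes `≠ 3`» ⟹ `Adm ∨ AdmUpToOne`;
* `Three.shapeGamma_or_threeSplit_of_multi_of_not_admissible` — multi ∧ ¬Adm ∧ ¬AdmUpToOne ⟹ (T2γ) ∨ three split primes `≠ 3` (contrapositive).

HONEST FRAMING: THEOREMS ONLY (no definition, no named fact, no `sorry`); pure bookkeeping over lane B's predicates; nothing about `Ш`, no display is
discharged; items 21420 ∕ 19111 are NOT closed; nothing about any curve's BSD; BSD is not advanced; T7. Credit: lane B corner3-p2 (predicates, roads),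
corner5-p2 (carrier lemmas), x11b3 ∕ multr1 (Kodaira–Néron at 3, place ∕ prime transport).
References (locators only): [cite: SilvermanATAEC1994, IV.9.4 Steps 2, 5, 8 and Cor. IV.9.2(d)] [cite: PastenShimura2024, Lemma 6.18 (shape of the half)]
[cite: Jetchev2008, Cor. 1.5 (the exempted place)] [cite: JetchevSkinnerWan2017, §7.4.2].
-/

set_option autoImplicit false
set_option linter.dupNamespace false -- `Summit.BirchSwinnertonDyer.BirchSwinnertonDyer` (summit = problem), tree-wide

noncomputable section

open scoped Classical NumberField

namespace Summit.BirchSwinnertonDyer.Rank1Residual.X11b.Three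

open WeierstrassCurve NumberField IsDedekindDomain Field Rat.HeightOneSpectrum
  Literature.NumberTheory.EllipticCurves
  Literature.NumberTheory.EllipticCurves.Rank1Residual
  Literature.NumberTheory.EllipticCurves.Rank1Residual.Typed
  Summit.BirchSwinnertonDyer.Rank1Residual Summit.BirchSwinnertonDyer.Rank1Residual.X11b
  Summit.BirchSwinnertonDyer.BirchSwinnertonDyer.Theorems

/-- **Carrier-inert admissibility at `3` is AUTOMATIC off (T2γ) with at most two split multiplicative primes other than `3`.** On a (T4″)₃
corner curve (`ClassX11b W 3`, `¬ Surj W 3`) with `¬ ShapeGamma W` (no place of type IV ∕ IV* with `c = 3`), MULTI-carrier (`ord₃ c_v < ord₃ Tam(E)`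
at every place) and NO three distinct split multiplicative primes `≠ 3`: `Three.CornerInertAdmissible W ∨ Three.CornerInertAdmissibleUpToOne W`.
Proof: two distinct places each split or with `c_v = 3` (`CornerLocal.CornerAtThree.forall_lt_iff_exists_two`); `c_v = 3` at a non-split place is
(T2γ) (`split_or_typeIV_of_odd_prime_dvd_localTamagawaNumber`); so a split multiplicative `q ≠ 3` exists (place ∕ prime transport); alone:
`S = {3, q}`, `R = {3}` (`3 ∤ 2`), SHAPE from `hshape_of_not_shapeGamma`; with a second `q'`: exempt `q'`, `S = {3, q}`, `R = {3}`, a split offender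
outside `S ∪ {q'}` would be a third. NO congruence condition. [cite: SilvermanATAEC1994, IV.9.4 and Cor. IV.9.2(d)] [cite: PastenShimura2024, Lemma 6.18 (shape)] -/
theorem cornerInertAdmissible_or_upToOne_of_not_shapeGamma_of_atMostTwoSplit [Fact (Nat.Prime 3)]
    (W : WeierstrassCurve ℚ) [W.IsElliptic] [W.IsGloballyMinimal]
    (hX : ClassX11b W 3) (hns : ¬ Surj W 3) (hγ : ¬ ShapeGamma W)
    (hmulti : ∀ v : HeightOneSpectrum (𝓞 ℚ), padicValNat 3 (W.tamagawaNumberAt v) < padicValNat 3 W.tamagawaProduct)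
    (h3 : ∀ (q₁ q₂ q₃ : ℕ) [Fact q₁.Prime] [Fact q₂.Prime] [Fact q₃.Prime], q₁ ≠ 3 → q₂ ≠ 3 → q₃ ≠ 3 →
      q₁ ≠ q₂ → q₁ ≠ q₃ → q₂ ≠ q₃ →
      W.HasSplitMultiplicativeReductionAtPrime q₁ → W.HasSplitMultiplicativeReductionAtPrime q₂ →
      W.HasSplitMultiplicativeReductionAtPrime q₃ → False) :
    CornerInertAdmissible W ∨ CornerInertAdmissibleUpToOne W := by
  have hmult3 : Mult W 3 := hX.2.2.1
  have hshape : ∀ (q : ℕ) [Fact q.Prime], 3 ∣ (W.baseChange ℚ_[q]).localTamagawaNumber ℤ_[q] →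
      W.HasSplitMultiplicativeReductionAtPrime q := hshape_of_not_shapeGamma W hγ
  -- every carrier place is split (off (T2γ))
  have hsplit_of : ∀ v : HeightOneSpectrum (𝓞 ℚ),
      (W.HasSplitMultiplicativeReductionAt v ∨ W.tamagawaNumberAt v = 3) → W.HasSplitMultiplicativeReductionAt v := by
    rintro v (hs | hc)
    · exact hs
    · have h3' : 3 ∣ W.tamagawaNumberAt v := by rw [hc]
      rcases split_or_typeIV_of_odd_prime_dvd_localTamagawaNumber W v Nat.prime_three (by decide) h3' with ⟨hs, -⟩ | ⟨-, hk, hc'⟩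
      · exact hs
      · exact absurd ⟨v, hk, hc'⟩ hγ
  -- two distinct split PLACES, hence a split multiplicative PRIME `q ≠ 3`
  obtain ⟨v₁, v₂, hne, h₁, h₂⟩ := (CornerLocal.CornerAtThree.forall_lt_iff_exists_two W hX hns).mp hmulti
  have hs₁ := hsplit_of v₁ h₁
  have hs₂ := hsplit_of v₂ h₂
  haveI i₁ : Fact (primesEquiv v₁ : ℕ).Prime := ⟨(primesEquiv v₁).2⟩
  haveI i₂ : Fact (primesEquiv v₂ : ℕ).Prime := ⟨(primesEquiv v₂).2⟩
  have hsq₁ : W.HasSplitMultiplicativeReductionAtPrime (primesEquiv v₁ : ℕ) :=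
    (W.hasSplitMultiplicativeReductionAtPrime_iff_hasSplitMultiplicativeReductionAt v₁).mpr hs₁
  have hsq₂ : W.HasSplitMultiplicativeReductionAtPrime (primesEquiv v₂ : ℕ) :=
    (W.hasSplitMultiplicativeReductionAtPrime_iff_hasSplitMultiplicativeReductionAt v₂).mpr hs₂
  have hq12 : (primesEquiv v₁ : ℕ) ≠ (primesEquiv v₂ : ℕ) := fun h ↦
    hne (primesEquiv.injective (Subtype.ext h))
  obtain ⟨q, hqF, hq3, hsq⟩ : ∃ (q : ℕ) (_ : Fact q.Prime), q ≠ 3 ∧ W.HasSplitMultiplicativeReductionAtPrime q := by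
    by_cases h : (primesEquiv v₁ : ℕ) = 3
    · exact ⟨(primesEquiv v₂ : ℕ), i₂, fun h' ↦ hq12 (h.trans h'.symm), hsq₂⟩
    · exact ⟨(primesEquiv v₁ : ℕ), i₁, h, hsq₁⟩
  haveI := hqF
  have hmq : Mult W q := hsq.hasMultiplicativeReductionAtPrime
  -- the set `S = {3, q}` with the half `R = {3}`
  have hSmult : ∀ ℓ ∈ ({3, q} : Finset ℕ), ∃ _ : Fact ℓ.Prime, Mult W ℓ := by
    intro ℓ hℓ
    rcases Finset.mem_insert.mp hℓ with rfl | hℓq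
    · exact ⟨inferInstance, hmult3⟩
    · rw [Finset.mem_singleton] at hℓq
      subst hℓq
      exact ⟨inferInstance, hmq⟩
  have hSeven : Even ({3, q} : Finset ℕ).card := by
    rw [Finset.card_pair (Ne.symm hq3)]
    exact ⟨1, rfl⟩
  have h3S : 3 ∈ ({3, q} : Finset ℕ) := by simp
  have hR : ∃ R ⊆ ({3, q} : Finset ℕ), ({3, q} : Finset ℕ).card = 2 * R.card ∧ ∀ q' ∈ R, q' ≠ 2 ∧ ¬ 3 ∣ q' - 1 := by
    refine ⟨{3}, by simp, by rw [Finset.card_pair (Ne.symm hq3), Finset.card_singleton], ?_⟩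
    intro q' hq'
    rw [Finset.mem_singleton] at hq'
    subst hq'
    decide
  by_cases h2 : ∃ (q' : ℕ) (_ : Fact q'.Prime), q' ≠ 3 ∧ q' ≠ q ∧ W.HasSplitMultiplicativeReductionAtPrime q'
  · -- a second split prime `q'`: exempt it
    obtain ⟨q', hq'F, hq'3, hq'q, hsq'⟩ := h2
    haveI := hq'F
    have hbad' : ¬ W.HasGoodReductionAtPrime q' :=
      WeierstrassCurve.HasMultiplicativeReduction.not_hasGoodReduction (R := ℤ_[q']) hsq'.hasMultiplicativeReductionAtPrime
    refine Or.inr ⟨q', hq'F, hbad', fun q'' _ _ h ↦ hshape q'' h, {3, q}, hSmult, hSeven, h3S, ?_, ?_, Or.inr hR⟩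
    · intro h
      rcases Finset.mem_insert.mp h with h₁' | h₂'
      · exact hq'3 h₁'
      · rw [Finset.mem_singleton] at h₂'
        exact hq'q h₂'
    · intro ℓ _ hℓS hℓq' hs
      have hℓ3 : ℓ ≠ 3 := fun h ↦ hℓS (by simp [h])
      have hℓq : ℓ ≠ q := fun h ↦ hℓS (by simp [h])
      exact (h3 q q' ℓ hq3 hq'3 hℓ3 hq'q.symm hℓq.symm (Ne.symm hℓq') hsq hsq' hs).elim
  · -- `q` is the only split prime `≠ 3`
    refine Or.inl ⟨fun q'' _ h ↦ hshape q'' h, {3, q}, hSmult, hSeven, ?_, Or.inr hR⟩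
    intro ℓ _ hℓS hs
    have hℓ3 : ℓ ≠ 3 := fun h ↦ hℓS (by simp [h])
    have hℓq : ℓ ≠ q := fun h ↦ hℓS (by simp [h])
    exact (h2 ⟨ℓ, inferInstance, hℓ3, hℓq, hs⟩).elim

/-- **The residual binder of lane B's `stub_upper3_residualMulti` (r4b) in CLEAN shape**: a (T4″)₃ corner curve that is multi-carrier and
admissible NEITHER as it stands NOR up to one exempted place is (T2γ) (`ShapeGamma W`: an additive place of type IV ∕ IV* with `c = 3`) OR has
three distinct split multiplicative primes `≠ 3`. Contrapositive of the previous theorem. So the IMC-grade `Three.CornerCoStepLAt` is asked only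
on «(T2γ) ∨ three-split» multi-carrier corner curves. Bookkeeping; nothing asserted about `Ш`. [cite: SilvermanATAEC1994, IV.9.4] -/
theorem shapeGamma_or_threeSplit_of_multi_of_not_admissible [Fact (Nat.Prime 3)]
    (W : WeierstrassCurve ℚ) [W.IsElliptic] [W.IsGloballyMinimal]
    (hX : ClassX11b W 3) (hns : ¬ Surj W 3)
    (hmulti : ∀ v : HeightOneSpectrum (𝓞 ℚ), padicValNat 3 (W.tamagawaNumberAt v) < padicValNat 3 W.tamagawaProduct)
    (hnA : ¬ CornerInertAdmissible W) (hnA1 : ¬ CornerInertAdmissibleUpToOne W) :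
    ShapeGamma W ∨
      ∃ (q₁ q₂ q₃ : ℕ) (_ : Fact q₁.Prime) (_ : Fact q₂.Prime) (_ : Fact q₃.Prime), q₁ ≠ 3 ∧ q₂ ≠ 3 ∧ q₃ ≠ 3 ∧
        q₁ ≠ q₂ ∧ q₁ ≠ q₃ ∧ q₂ ≠ q₃ ∧ W.HasSplitMultiplicativeReductionAtPrime q₁ ∧
        W.HasSplitMultiplicativeReductionAtPrime q₂ ∧ W.HasSplitMultiplicativeReductionAtPrime q₃ := by
  by_cases hγ : ShapeGamma W
  · exact Or.inl hγ
  · right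
    by_contra hno
    have h3 : ∀ (q₁ q₂ q₃ : ℕ) [Fact q₁.Prime] [Fact q₂.Prime] [Fact q₃.Prime], q₁ ≠ 3 → q₂ ≠ 3 → q₃ ≠ 3 →
        q₁ ≠ q₂ → q₁ ≠ q₃ → q₂ ≠ q₃ →
        W.HasSplitMultiplicativeReductionAtPrime q₁ → W.HasSplitMultiplicativeReductionAtPrime q₂ →
        W.HasSplitMultiplicativeReductionAtPrime q₃ → False :=
      fun q₁ q₂ q₃ _ _ _ h1 h2 h3' h12 h13 h23 hs1 hs2 hs3 ↦
        hno ⟨q₁, q₂, q₃, inferInstance, inferInstance, inferInstance, h1, h2, h3', h12, h13, h23, hs1, hs2, hs3⟩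
    rcases cornerInertAdmissible_or_upToOne_of_not_shapeGamma_of_atMostTwoSplit W hX hns hγ hmulti h3 with hA | hA1
    · exact hnA hA
    · exact hnA1 hA1

end Summit.BirchSwinnertonDyer.Rank1Residual.X11b.Three

end
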